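import Summits.AtomisticToContinuum.HydrodynamicLimit.Theorems.InformationPercolationEngineLocalSecondLawInitialMatchingTerm1Decomp
import Summits.AtomisticToContinuum.HydrodynamicLimit.Theorems.InformationPercolationEngineLocalSecondLawInitialMatchingEntropyModulus

/-!
# Stub B′|ML (`stub_initialMatchingOfStatics`) of the line `contact-asymmetry-information` for the crux `LocalSecondLaw`
(stmt-AtomisticToContinuum-13081) — part 5b: the cone-smeared kinetic entropy of a bounded tilt at `s = 0` (Term 1 of B′)

The ENTROPY term of the initial matching, uniformly in the centre `x`: for a one-particle density `f` of a bounded tilt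
`P_N(·|S)` (`P_N(S) ≥ δ″`), the cone-smeared kinetic entropy `h̄(0, x) = ∫ b_r(y,x) (∫ f log f dv) dy` (`hBar` of the ensemble
vocabulary) is compared with the same smearing of the local-equilibrium value `n log n − (3/2) log(2πθ₀) n − (3/2) n` at a
comparison density `n` (later `ρ₀`):

  `|h̄(0,x) − ∫ b_r (n log n − (3/2) log(2πθ₀) n − (3/2) n)| ≤ (3/(πr³)) (b + (1 + log K₁)κ + 2√κ + (3/2) L_θ κ + ε_E + (3/2) κ)`

(`t1_hBar_sub_le`), where `b = log(1/P_N(S))/(N+1)` (velocity relative-entropy budget, part 3b), `ε_E = δ″⁻¹ √(K/4/(N+1))`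
(peculiar-energy matching, part 4b), `κ ≥ ∫ |n_S − n|`, `n_S, n ≤ K₁`, `|log(2πθ₀)| ≤ L_θ`.  The proof is the slice decomposition
`h₁ = k + n_S log n_S − (3/2) log(2πθ₀) n_S − e` (part 5a) integrated against the cone, with `0 ≤ ∫ b_r k ≤ (3/(πr³)) b`, the
position-entropy modulus (part 2) for `∫ b_r (n_S log n_S − n log n)`, and Fubini for the energy term.

References: H. Spohn, *Large Scale Dynamics of Interacting Particles* (1991), Part I §2.3; I. Csiszár, J. Körner, *Information
Theory* (2011), Lemma 2.7.  Lead c16 (prover-line-stmt-AtomisticToContinuum-13081-c16-0).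
-/

noncomputable section

open scoped BigOperators Topology Classical MeasureTheory ENNReal InnerProductSpace
open Filter Set MeasureTheory Function
open Literature.MathematicalPhysics.KineticTheory
open Literature.Analysis.FluidPDE
open Summit.AtomisticToContinuum.HydrodynamicLimit.Theorems.LocalSecondLawNegative
open Summit.AtomisticToContinuum.HydrodynamicLimit.Theorems.LocalSecondLawLedger
open Summit.AtomisticToContinuum.HydrodynamicLimit.Theorems.LocalSecondLawContact

namespace Summit.AtomisticToContinuum.HydrodynamicLimit.Theorems.LocalSecondLawInitialMatching

variable {N : ℕ}

/-! ### Fubini helpers on `𝕋³ × ℝ³` -/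

/-- The slice integral `y ↦ ∫ F(y,v) dv` of a product-integrable `F` is integrable and `∫ (∫ F(y,v) dv) dy = ∫ F`. -/
theorem t1_integral_slice {F : T3 × V3 → ℝ} (hF : Integrable F) :
    Integrable (fun y : T3 => ∫ v : V3, F (y, v)) ∧ ∫ y : T3, ∫ v : V3, F (y, v) = ∫ p, F p := by
  have h : Integrable F ((volume : Measure T3).prod (volume : Measure V3)) := by
    rw [← Measure.volume_eq_prod]; exact hF
  refine ⟨h.integral_prod_left, ?_⟩
  rw [← integral_prod _ h, ← Measure.volume_eq_prod]

/-- A weighted double integral: `∫ w(y) (∫ F(y,v) dv) dy = ∫ w(p.1) F(p) dp` for bounded measurable `w` and product-integrable `F`. -/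
theorem t1_integral_weight_slice {F : T3 × V3 → ℝ} (hF : Integrable F) {w : T3 → ℝ} (hwm : Measurable w) {C : ℝ}
    (hwC : ∀ y, |w y| ≤ C) :
    Integrable (fun p : T3 × V3 => w p.1 * F p) ∧
      ∫ y : T3, w y * ∫ v : V3, F (y, v) = ∫ p : T3 × V3, w p.1 * F p := by
  have hwF : Integrable fun p : T3 × V3 => w p.1 * F p :=
    hF.bdd_mul (hwm.comp measurable_fst).aestronglyMeasurable (ae_of_all _ fun p => by
      rw [Real.norm_eq_abs]; exact hwC p.1)
  refine ⟨hwF, ?_⟩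
  rw [← (t1_integral_slice hwF).2]
  refine integral_congr_ae (ae_of_all _ fun y => ?_)
  exact (integral_const_mul (w y) _).symm

/-! ### Term 1 of the initial matching -/

/-- **The cone-smeared kinetic entropy of a bounded tilt (Term 1 of B′), uniformly in the centre.**  See the module docstring for
the statement; hypotheses: continuous profiles `a₀, θ₀ > 0`, `u₀`; `σ ≤ 1/2`; a cell with `P_N(S) ≥ δ″ > 0`; a one-particle density
`f` of `P_N(·|S)` on `[0,τ]`; a continuous comparison density `0 ≤ n ≤ K₁` (`K₁ ≥ 1`) with `n_S ≤ K₁` a.e. and `∫|n_S − n| ≤ κ`;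
`|log(2πθ₀)| ≤ L_θ`; radius `r > 0`. -/
theorem t1_hBar_sub_le : ∀ {a₀ θ₀ : T3 → ℝ} {u₀ : T3 → V3} (ha : Continuous a₀) (hθ : Continuous θ₀) (hu : Continuous u₀) (ha0 : ∀ x, 0 < a₀ x) (hθ0 : ∀ x, 0 < θ₀ x) {σ : ℝ}, σ ≤ 1 / 2 → ∀ {N : ℕ} {τ : ℝ}, 0 ≤ τ → ∀ (Φ : Flow σ N) (S : Set (Phase N)) {δ'' : ℝ}, 0 < δ'' → ENNReal.ofReal δ'' ≤ localGibbsLaw σ a₀ u₀ θ₀ N Φ S → ∀ (f : Pt1 → ℝ), IsOneParticleDensity τ (condLaw (localGibbsLaw σ a₀ u₀ θ₀ N Φ) S) Φ f → ∀ {n : T3 → ℝ}, Continuous n → (∀ y, 0 ≤ n y) → ∀ {K₁ κ L r : ℝ}, 1 ≤ K₁ → 0 < r → (∀ y, n y ≤ K₁) → (∀ᵐ y : T3, (∫ v : V3, f (0, y, v)) ≤ K₁) → ∫ y : T3, |(∫ v : V3, f (0, y, v)) - n y| ≤ κ → (∀ y, |Real.log (2 * Real.pi * θ₀ y)| ≤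 L) → ∀ x : T3, |hBar r f 0 x - ∫ y, cone r y x * (n y * Real.log (n y) - 3 / 2 * Real.log (2 * Real.pi * θ₀ y) * n y - 3 / 2 * n y)| ≤ 3 / (Real.pi * r ^ 3) * (Real.log ((localGibbsLaw σ a₀ u₀ θ₀ N Φ S).toReal⁻¹) / (N + 1) + ((1 + Real.log K₁) * κ + 2 * Real.sqrt κ) + 3 / 2 * L * κ + δ''⁻¹ * Real.sqrt (gaussFourthMomentConst (Fin 3) / 4 / (N + 1 : ℕ)) + 3 / 2 * κ) := by
  intro a₀ θ₀ u₀ ha hθ hu ha0 hθ0 σ hσ N τ hτ Φ S δ'' hδ hS f hf n hn hn0 K₁ κ L r hK₁ hr hnK hnSK hL1 hL x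
  set μ : Measure (Phase N) := localGibbsLaw σ a₀ u₀ θ₀ N Φ with hμ
  haveI : IsProbabilityMeasure μ := isProbabilityMeasure_localGibbsLaw ha hθ hu ha0 hθ0 hσ N Φ
  set ν : Measure (Phase N) := condLaw μ S with hν
  haveI : IsProbabilityMeasure ν := contactB_condLaw_isProbability_of_floor μ S δ'' hδ hS
  have hS0 : μ S ≠ 0 := fun h0 => by
    rw [h0] at hS
    exact absurd (nonpos_iff_eq_zero.1 hS) (by rw [ENNReal.ofReal_eq_zero]; linarith)
  -- constants
  set C : ℝ := 3 / (Real.pi * r ^ 3) with hC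
  have hC0 : 0 < C := by positivity
  set b : ℝ := Real.log ((μ S).toReal⁻¹) / (N + 1) with hb
  set εE : ℝ := δ''⁻¹ * Real.sqrt (gaussFourthMomentConst (Fin 3) / 4 / (N + 1 : ℕ)) with hεE
  have hκ : 0 ≤ κ := (integral_nonneg fun y => abs_nonneg _).trans hL1
  have hL0 : 0 ≤ L := (abs_nonneg _).trans (hL x)
  -- the objects
  set nS : T3 → ℝ := fun y => ∫ v : V3, f (0, y, v) with hnS
  set FL : T3 × V3 → ℝ := fun p => f (0, p) *
    Real.log (f (0, p) / ((∫ v, f (0, p.1, v)) * localMaxwellian 1 (θ₀ p.1) (u₀ p.1) p.2)) with hFL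
  set qF : T3 × V3 → ℝ := fun p => ‖p.2 - u₀ p.1‖ ^ 2 / (2 * θ₀ p.1) * f (0, p) with hqF
  set k : T3 → ℝ := fun y => ∫ v : V3, FL (y, v) with hk
  set e : T3 → ℝ := fun y => ∫ v : V3, qF (y, v) with he
  set lg : T3 → ℝ := fun y => Real.log (2 * Real.pi * θ₀ y) with hlg
  have hf0 : ∀ p, 0 ≤ f p := fun p => hf.1 p
  have hnSm : Measurable nS := tv_measurable_posDensity hf
  have hnSi : Integrable nS := tv_integrable_posDensity ν Φ f hτ hf
  have hnS0 : ∀ y, 0 ≤ nS y := fun y => tv_posDensity_nonneg hf y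
  have hnm : Measurable n := hn.measurable
  have hni : Integrable n := MesoLLN.integrable_T3 hn
  have hlgm : Measurable lg := Real.measurable_log.comp ((hθ.measurable).const_mul _)
  -- product integrabilities (parts 3b, 4b)
  obtain ⟨hFLi, hFLle⟩ := kl_velocity_budget ha hθ hu ha0 hθ0 hσ hτ Φ S f hS0 hf
  have hqFi : Integrable qF := by
    obtain ⟨h3i, -⟩ := en_energy_matching ha hθ hu ha0 hθ0 hσ hτ Φ S hδ hS f hf (fun _ => (1 : ℝ)) measurable_const
      (fun _ => zero_le_one) (fun _ => le_rfl)
    exact h3i.congr (ae_of_all _ fun p => by rw [hqF]; dsimp only; rw [one_mul])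
  obtain ⟨hki, hk_eq⟩ := t1_integral_slice hFLi
  obtain ⟨hei, -⟩ := t1_integral_slice hqFi
  -- cone facts
  have hc0 : ∀ y, 0 ≤ cone r y x := fun y => cone_nonneg hr y x
  have hcC : ∀ y, cone r y x ≤ C := fun y => contactB_cone_le_const hr y x
  have hcabs : ∀ y, |cone r y x| ≤ C := fun y => by rw [abs_of_nonneg (hc0 y)]; exact hcC y
  have hcm : Measurable fun y => cone r y x := (contactB_continuous_cone_left r x).measurable
  -- the normalised weight `w = cone / C ∈ [0,1]`
  set w : T3 → ℝ := fun y => C⁻¹ * cone r y x with hw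
  have hwm : Measurable w := hcm.const_mul _
  have hw0 : ∀ y, 0 ≤ w y := fun y => mul_nonneg (inv_nonneg.2 hC0.le) (hc0 y)
  have hw1 : ∀ y, w y ≤ 1 := fun y => by
    rw [hw]; dsimp only
    rw [inv_mul_le_iff₀ hC0, mul_one]; exact hcC y
  have hcw : ∀ y, cone r y x = C * w y := fun y => by rw [hw]; dsimp only; field_simp
  -- good positions: the decomposition `h1 = k + nS log nS − 3/2 lg nS − e` a.e.
  have hgood := t1_ae_good ha hθ hu ha0 hθ0 hσ hτ Φ S hδ hS f hf
  have hdec : ∀ᵐ y : T3, h1 f 0 y = k y + Real.log (nS y) * nS y - 3 / 2 * lg y * nS y - e y := by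
    filter_upwards [hgood] with y hy
    obtain ⟨-, h⟩ := t1_h1_eq hθ0 hf0 hy.1 hy.2.1 hy.2.2
    rw [h]
  have hknn : ∀ᵐ y : T3, 0 ≤ k y := by
    filter_upwards [hgood] with y hy
    exact t1_k_nonneg hθ0 hf0 hy.1 hy.2.1
  -- integrability of the position pieces
  have hnSlog_m : Measurable fun y => Real.log (nS y) * nS y := (Real.measurable_log.comp hnSm).mul hnSm
  have hnSlog_i : Integrable fun y => Real.log (nS y) * nS y := by
    refine (integrable_const (K₁ * Real.log K₁ + 1)).mono' hnSlog_m.aestronglyMeasurable ?_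
    filter_upwards [hnSK] with y hy
    rw [Real.norm_eq_abs, mul_comm]
    exact em_abs_mul_log_le (hnS0 y) hy hK₁
  have hnSlog_i' : Integrable fun y => nS y * Real.log (nS y) :=
    hnSlog_i.congr (ae_of_all _ fun y => mul_comm _ _)
  have hlgnS_i : Integrable fun y => lg y * nS y :=
    hnSi.bdd_mul hlgm.aestronglyMeasurable (ae_of_all _ fun y => by rw [Real.norm_eq_abs]; exact hL y)
  -- hBar as the sum of four cone integrals
  set IK : ℝ := ∫ y, cone r y x * k y with hIK
  set IP : ℝ := ∫ y, cone r y x * (nS y * Real.log (nS y)) with hIP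
  set ILg : ℝ := ∫ y, cone r y x * (lg y * nS y) with hILg
  set IE : ℝ := ∫ y, cone r y x * e y with hIE
  have hci : ∀ {g : T3 → ℝ}, Integrable g → Integrable fun y => cone r y x * g y := fun hg =>
    hg.bdd_mul hcm.aestronglyMeasurable (ae_of_all _ fun y => by rw [Real.norm_eq_abs]; exact hcabs y)
  have hHbar : hBar r f 0 x = IK + IP - 3 / 2 * ILg - IE := by
    have e1 : hBar r f 0 x = ∫ y, cone r y x * (k y + Real.log (nS y) * nS y - 3 / 2 * lg y * nS y - e y) := by
      unfold hBar
      refine integral_congr_ae ?_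
      filter_upwards [hdec] with y hy
      rw [hy]
    rw [e1]
    have i1 : Integrable fun y => cone r y x * k y := hci hki
    have i2 : Integrable fun y => cone r y x * (nS y * Real.log (nS y)) := hci hnSlog_i'
    have i3 : Integrable fun y => 3 / 2 * (cone r y x * (lg y * nS y)) := (hci hlgnS_i).const_mul _
    have i4 : Integrable fun y => cone r y x * e y := hci hei
    have i12 : Integrable fun y => cone r y x * k y + cone r y x * (nS y * Real.log (nS y)) := i1.add i2
    have i123 : Integrable fun y => cone r y x * k y + cone r y x * (nS y * Real.log (nS y)) -
        3 / 2 * (cone r y x * (lg y * nS y)) := i12.sub i3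
    have e2 : (fun y => cone r y x * (k y + Real.log (nS y) * nS y - 3 / 2 * lg y * nS y - e y)) =
        fun y => cone r y x * k y + cone r y x * (nS y * Real.log (nS y)) - 3 / 2 * (cone r y x * (lg y * nS y)) -
          cone r y x * e y := by
      funext y; ring
    rw [e2, integral_sub i123 i4, integral_sub i12 i3, integral_add i1 i2, integral_const_mul]
  -- the comparison integral as three cone integrals
  have hnlog_c : Continuous fun y => n y * Real.log (n y) := Real.continuous_mul_log.comp hn
  set JP : ℝ := ∫ y, cone r y x * (n y * Real.log (n y)) with hJP
  set JLg : ℝ := ∫ y, cone r y x * (lg y * n y) with hJLg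
  set Jn : ℝ := ∫ y, cone r y x * n y with hJn
  have hlgn_i : Integrable fun y => lg y * n y :=
    hni.bdd_mul hlgm.aestronglyMeasurable (ae_of_all _ fun y => by rw [Real.norm_eq_abs]; exact hL y)
  have hA : ∫ y, cone r y x * (n y * Real.log (n y) - 3 / 2 * Real.log (2 * Real.pi * θ₀ y) * n y - 3 / 2 * n y) =
      JP - 3 / 2 * JLg - 3 / 2 * Jn := by
    have j1 : Integrable fun y => cone r y x * (n y * Real.log (n y)) := hci (MesoLLN.integrable_T3 hnlog_c)
    have j2 : Integrable fun y => 3 / 2 * (cone r y x * (lg y * n y)) := (hci hlgn_i).const_mul _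
    have j3 : Integrable fun y => 3 / 2 * (cone r y x * n y) := (hci hni).const_mul _
    have j12 : Integrable fun y => cone r y x * (n y * Real.log (n y)) - 3 / 2 * (cone r y x * (lg y * n y)) := j1.sub j2
    have e3 : (fun y => cone r y x * (n y * Real.log (n y) - 3 / 2 * Real.log (2 * Real.pi * θ₀ y) * n y - 3 / 2 * n y)) =
        fun y => cone r y x * (n y * Real.log (n y)) - 3 / 2 * (cone r y x * (lg y * n y)) - 3 / 2 * (cone r y x * n y) := by
      funext y; rw [hlg]; ring
    rw [e3, integral_sub j12 j3, integral_sub j1 j2, integral_const_mul, integral_const_mul]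
  -- (TK) the velocity relative entropy: `0 ≤ IK ≤ C b`
  have hTK : 0 ≤ IK ∧ IK ≤ C * b := by
    constructor
    · refine integral_nonneg_of_ae ?_
      filter_upwards [hknn] with y hy
      exact mul_nonneg (hc0 y) hy
    · calc IK ≤ ∫ y, C * k y := by
            refine integral_mono_ae (hci hki) (hki.const_mul C) ?_
            filter_upwards [hknn] with y hy
            exact mul_le_mul_of_nonneg_right (hcC y) hy
        _ = C * ∫ p, FL p := by rw [integral_const_mul, ← hk_eq]
        _ ≤ C * b := mul_le_mul_of_nonneg_left hFLle hC0.le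
  -- (TP) the position entropy
  have hTP : |IP - JP| ≤ C * ((1 + Real.log K₁) * κ + 2 * Real.sqrt κ) := by
    have e4 : IP - JP = ∫ y, cone r y x * (nS y * Real.log (nS y) - n y * Real.log (n y)) := by
      rw [hIP, hJP, ← integral_sub (hci hnSlog_i') (hci (MesoLLN.integrable_T3 hnlog_c))]
      refine integral_congr_ae (ae_of_all _ fun y => ?_)
      show cone r y x * (nS y * Real.log (nS y)) - cone r y x * (n y * Real.log (n y)) = _
      ring
    rw [e4]
    exact em_cone_entropy_sub_le hK₁ hr hnSm hnS0 hnSK hnm hn0 hnK hnSi hni hL1 x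
  -- (TL) the logarithmic weight
  have hTL : |ILg - JLg| ≤ C * L * κ := by
    have hdi : Integrable fun y => nS y - n y := hnSi.sub hni
    have e5 : ILg - JLg = ∫ y, cone r y x * lg y * (nS y - n y) := by
      rw [hILg, hJLg, ← integral_sub (hci hlgnS_i) (hci hlgn_i)]
      refine integral_congr_ae (ae_of_all _ fun y => ?_)
      show cone r y x * (lg y * nS y) - cone r y x * (lg y * n y) = cone r y x * lg y * (nS y - n y)
      ring
    rw [e5]
    have hbd : ∀ y, |cone r y x * lg y * (nS y - n y)| ≤ C * L * |nS y - n y| := by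
      intro y
      rw [abs_mul, abs_mul, abs_of_nonneg (hc0 y)]
      exact mul_le_mul_of_nonneg_right (mul_le_mul (hcC y) (hL y) (abs_nonneg _) hC0.le) (abs_nonneg _)
    calc |∫ y, cone r y x * lg y * (nS y - n y)| ≤ ∫ y, |cone r y x * lg y * (nS y - n y)| := abs_integral_le_integral_abs
      _ ≤ ∫ y, C * L * |nS y - n y| := by
          refine integral_mono_of_nonneg (ae_of_all _ fun y => abs_nonneg _) (hdi.abs.const_mul _)
            (ae_of_all _ hbd)
      _ = C * L * ∫ y, |nS y - n y| := integral_const_mul _ _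
      _ ≤ C * L * κ := mul_le_mul_of_nonneg_left hL1 (by positivity)
  -- (TE) the peculiar energy
  have hTE : |IE - 3 / 2 * Jn| ≤ C * εE + 3 / 2 * C * κ := by
    obtain ⟨hwqi, hwq⟩ := en_energy_matching ha hθ hu ha0 hθ0 hσ hτ Φ S hδ hS f hf w hwm hw0 hw1
    -- `IE = C ∫∫ w q f`
    obtain ⟨-, hIE'⟩ := t1_integral_weight_slice hqFi hcm hcabs
    have e6 : IE = C * ∫ p : T3 × V3, w p.1 * (‖p.2 - u₀ p.1‖ ^ 2 / (2 * θ₀ p.1)) * f (0, p) := by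
      rw [hIE, hIE', ← integral_const_mul]
      refine integral_congr_ae (ae_of_all _ fun p => ?_)
      show cone r p.1 x * qF p = C * (w p.1 * (‖p.2 - u₀ p.1‖ ^ 2 / (2 * θ₀ p.1)) * f (0, p))
      rw [hcw p.1, hqF]; ring
    -- `∫ cone nS = C ∫ w nS`
    have e7 : ∫ y, cone r y x * nS y = C * ∫ y, w y * nS y := by
      rw [← integral_const_mul]
      refine integral_congr_ae (ae_of_all _ fun y => ?_)
      show cone r y x * nS y = C * (w y * nS y)
      rw [hcw y]; ring
    have e8 : IE - 3 / 2 * Jn = C * ((∫ p : T3 × V3, w p.1 * (‖p.2 - u₀ p.1‖ ^ 2 / (2 * θ₀ p.1)) * f (0, p)) -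
        3 / 2 * ∫ y, w y * nS y) + 3 / 2 * ∫ y, cone r y x * (nS y - n y) := by
      have e9 : ∫ y, cone r y x * (nS y - n y) = (∫ y, cone r y x * nS y) - Jn := by
        rw [hJn, ← integral_sub (hci hnSi) (hci hni)]
        refine integral_congr_ae (ae_of_all _ fun y => ?_)
        show cone r y x * (nS y - n y) = cone r y x * nS y - cone r y x * n y
        ring
      rw [e9, e6, e7]; ring
    rw [e8]
    have hsec : |∫ y, cone r y x * (nS y - n y)| ≤ C * κ := by
      have hdi : Integrable fun y => nS y - n y := hnSi.sub hni
      calc |∫ y, cone r y x * (nS y - n y)| ≤ ∫ y, |cone r y x * (nS y - n y)| := abs_integral_le_integral_abs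
        _ ≤ ∫ y, C * |nS y - n y| := by
            refine integral_mono_of_nonneg (ae_of_all _ fun y => abs_nonneg _) (hdi.abs.const_mul _)
              (ae_of_all _ fun y => ?_)
            show |cone r y x * (nS y - n y)| ≤ C * |nS y - n y|
            rw [abs_mul, abs_of_nonneg (hc0 y)]
            exact mul_le_mul_of_nonneg_right (hcC y) (abs_nonneg _)
        _ = C * ∫ y, |nS y - n y| := integral_const_mul _ _
        _ ≤ C * κ := mul_le_mul_of_nonneg_left hL1 hC0.le
    calc |C * ((∫ p : T3 × V3, w p.1 * (‖p.2 - u₀ p.1‖ ^ 2 / (2 * θ₀ p.1)) * f (0, p)) - 3 / 2 * ∫ y, w y * nS y) +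
          3 / 2 * ∫ y, cone r y x * (nS y - n y)|
        ≤ |C * ((∫ p : T3 × V3, w p.1 * (‖p.2 - u₀ p.1‖ ^ 2 / (2 * θ₀ p.1)) * f (0, p)) - 3 / 2 * ∫ y, w y * nS y)| +
          |3 / 2 * ∫ y, cone r y x * (nS y - n y)| := abs_add_le _ _
      _ ≤ C * εE + 3 / 2 * (C * κ) := by
          rw [abs_mul, abs_of_pos hC0, abs_mul, abs_of_pos (by norm_num : (0 : ℝ) < 3 / 2)]
          exact add_le_add (mul_le_mul_of_nonneg_left hwq hC0.le) (mul_le_mul_of_nonneg_left hsec (by norm_num))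
      _ = C * εE + 3 / 2 * C * κ := by ring
  -- assemble
  have hdiff : hBar r f 0 x - ∫ y, cone r y x * (n y * Real.log (n y) - 3 / 2 * Real.log (2 * Real.pi * θ₀ y) * n y - 3 / 2 * n y) =
      IK + (IP - JP) - 3 / 2 * (ILg - JLg) - (IE - 3 / 2 * Jn) := by
    rw [hHbar, hA]; ring
  rw [hdiff]
  have h1 : |IK + (IP - JP) - 3 / 2 * (ILg - JLg) - (IE - 3 / 2 * Jn)| ≤
      |IK| + |IP - JP| + 3 / 2 * |ILg - JLg| + |IE - 3 / 2 * Jn| := by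
    have a1 := abs_sub (IK + (IP - JP) - 3 / 2 * (ILg - JLg)) (IE - 3 / 2 * Jn)
    have a2 := abs_sub (IK + (IP - JP)) (3 / 2 * (ILg - JLg))
    have a3 := abs_add_le IK (IP - JP)
    have a4 : |3 / 2 * (ILg - JLg)| = 3 / 2 * |ILg - JLg| := by
      rw [abs_mul, abs_of_pos (by norm_num : (0 : ℝ) < 3 / 2)]
    linarith
  have hIKabs : |IK| = IK := abs_of_nonneg hTK.1
  rw [hIKabs] at h1
  have hsum : IK + |IP - JP| + 3 / 2 * |ILg - JLg| + |IE - 3 / 2 * Jn| ≤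
      C * (b + ((1 + Real.log K₁) * κ + 2 * Real.sqrt κ) + 3 / 2 * L * κ + εE + 3 / 2 * κ) := by
    have := hTK.2
    nlinarith [hTP, hTL, hTE, hC0.le, hκ, hL0]
  exact h1.trans hsum

end Summit.AtomisticToContinuum.HydrodynamicLimit.Theorems.LocalSecondLawInitialMatching

end
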